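import Mathlib
import HarnessLib
import Summits.AtomisticToContinuum.FouriersLaw.Theses.JunctionLocality
import Summits.AtomisticToContinuum.FouriersLaw.Theorems.JunctionLocalitySuperadditiveResistanceStubPlainForwardFieldAux2

/-!
# The plain chain's equilibrium forward field, III: the Poisson equation in `𝓓'` for `∫₀^∞ P_t k dt`

Helper file 3 (`--supports` stmt-AtomisticToContinuum-11748) for stub `stub_plainForwardField` of
line `floating-probe-bypass-laplacian` (crux `JunctionLocality.SuperadditiveResistance`); pinned
chain `pinnedChain ω₂ lam β γ` (`ω₂ > 0`, `lam, β, γ ≥ 0`, `N ≥ 1`) at equal bath temperatures `T`.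

* `integral_mul_act_sub_eq` — the time-integrated backward equation of file II,
  `∫ φ (P_τ k) dx − ∫ φ k dx = ∫₀^τ ∫ (L̂φ + 2γφ)(P_t k) dx dt`, for smooth `k` with `|k| ≤ K e^{ϑH}`
  (`0 < ϑ < 1/T`; e.g. `p_0² − T`): energy cutoffs `k χ(H/(n+1))` and dominated convergence
  (`tendsto_integral_mul_act`) with the moment bound (3.4) `P_t|k| ≤ K e^{2ϑγTt} e^{ϑH}`.
* `integral_transpose_mul_forwardIntegral` — if moreover the averages DECAY,
  `|P_t k(z)| ≤ M e^{ϑH(z)} e^{−ct}` (`c > 0`; for `k = p_0² − T` this is CEHR (2.5) at equilibrium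
  with `μ_T(k) = 0`), then `g₀ = ∫₀^∞ P_t k dt` (measurable, `|g₀| ≤ M (∫₀^∞e^{−ct}dt) e^{ϑH}`:
  `stronglyMeasurable_forwardIntegral`, `abs_forwardIntegral_le`) solves the POISSON EQUATION
  `L g₀ = −k` IN `𝓓'`: `∫ (L̂φ + 2γφ) g₀ dx = −∫ φ k dx` for all `φ ∈ C_c^∞` (`L̂ + 2γ = ᵗL`,
  file I) — let `τ → ∞` (decay, integrability, Fubini).

References: Cuneo–Eckmann–Hairer–Rey-Bellet, EJP 23 (2018) no. 55, §3, Thm 2.13 (3); Dynkin (1965) Ch. I §2.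
-/

noncomputable section

open MeasureTheory ProbabilityTheory Filter Topology Set
open scoped ContDiff NNReal ENNReal
open Literature.MathematicalPhysics.KineticTheory.HeatConduction
open Literature.MathematicalPhysics.KineticTheory Literature.Probability.Process OscillatorChain
open Summit.AtomisticToContinuum.FouriersLaw.Theorems.SubdiffusiveBondHeat

namespace Summit.AtomisticToContinuum.FouriersLaw.Theorems.SuperadditiveResistance.PlainForwardField

variable {N : ℕ}

section Pinned

variable {ω₂ lam β γ : ℝ} (hω : 0 < ω₂) (hl : 0 ≤ lam) (hβ : 0 ≤ β) (hγ : 0 ≤ γ) (hN : 0 < N)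
  {T : ℝ} (hT : 0 < T)
include hω hl hβ hγ

/-! ## Removing the cutoff: unbounded observables dominated by `e^{ϑH}` -/

include hN hT in
/-- **Dominated convergence for `∫ θ (P_t k_n) dx`**: if `k_n → k` pointwise with `|k_n| ≤ |k|`,
`k` continuous with `|k| ≤ K e^{ϑH}` (`0 < ϑ < 1/T`), all `k_n` continuous and `θ` continuous
compactly supported, then `∫ θ (P_t k_n) dx → ∫ θ (P_t k) dx`. [folklore] -/
theorem tendsto_integral_mul_act {ϑ K : ℝ} (hϑ0 : 0 < ϑ) (hϑ1 : ϑ < 1 / T)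
    {k : PhaseSpace N → ℝ} (hk : Continuous k)
    (hkb : ∀ y, |k y| ≤ K * Real.exp (ϑ * (pinnedChain ω₂ lam β γ).hamiltonian N y))
    {kn : ℕ → PhaseSpace N → ℝ} (hkn : ∀ n, Continuous (kn n)) (hknle : ∀ n y, |kn n y| ≤ |k y|)
    (hlim : ∀ y, Tendsto (fun n => kn n y) atTop (𝓝 (k y))) {θ : PhaseSpace N → ℝ}
    (hθ : Continuous θ) (hθc : HasCompactSupport θ) (t : ℝ≥0) :
    Tendsto (fun n => ∫ x, θ x * ∫ y, kn n y ∂((pinnedChain ω₂ lam β γ).langevinKernel N T T t x))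
      atTop (𝓝 (∫ x, θ x * ∫ y, k y ∂((pinnedChain ω₂ lam β γ).langevinKernel N T T t x))) := by
  set P := pinnedChain ω₂ lam β γ with hPdef
  set κ := P.langevinKernel N T T t with hκ
  -- inner convergence, pointwise in `x`
  have hin : ∀ x, Tendsto (fun n => ∫ y, kn n y ∂(κ x)) atTop (𝓝 (∫ y, k y ∂(κ x))) := by
    intro x
    obtain ⟨hkint, -⟩ := integral_abs_le_of_abs_le_exp hω hl hβ hγ hN hT hϑ0 hϑ1 hk hkb t x
    refine tendsto_integral_of_dominated_convergence (fun y => |k y|)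
      (fun n => (hkn n).aestronglyMeasurable) hkint.abs (fun n => Eventually.of_forall fun y => ?_)
      (Eventually.of_forall hlim)
    rw [Real.norm_eq_abs]; exact hknle n y
  -- domination in `x`
  set G : PhaseSpace N → ℝ := fun x => |θ x| * (K * Real.exp (ϑ * γ * (T + T) * t) *
    Real.exp (ϑ * P.hamiltonian N x)) with hG
  have hGc : Continuous G := by
    have := pinnedChain_continuous_hamiltonian ω₂ lam β γ N
    rw [hG]; fun_prop
  have hGs : HasCompactSupport G := hθc.norm.mul_right
  have hGint : Integrable G volume := hGc.integrable_of_hasCompactSupport hGs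
  refine tendsto_integral_of_dominated_convergence G (fun n => ?_) hGint
    (fun n => Eventually.of_forall fun x => ?_) (Eventually.of_forall fun x => (hin x).const_mul _)
  · exact hθ.aestronglyMeasurable.mul
      ((hkn n).stronglyMeasurable.integral_kernel (κ := κ)).aestronglyMeasurable
  · obtain ⟨hkint, hbd⟩ := integral_abs_le_of_abs_le_exp hω hl hβ hγ hN hT hϑ0 hϑ1 hk hkb t x
    rw [norm_mul, Real.norm_eq_abs, Real.norm_eq_abs]
    refine mul_le_mul_of_nonneg_left ?_ (abs_nonneg _)
    calc |∫ y, kn n y ∂(κ x)| ≤ ∫ y, |kn n y| ∂(κ x) := abs_integral_le_integral_abs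
      _ ≤ ∫ y, |k y| ∂(κ x) := integral_mono_of_nonneg (Eventually.of_forall fun y => abs_nonneg _)
          hkint.abs (Eventually.of_forall (hknle n))
      _ ≤ _ := hbd

include hN hT in
/-- **The time-integrated backward equation for an `e^{ϑH}`-dominated observable**: for the pinned
chain at equal temperatures, `φ ∈ C_c^∞`, `k ∈ C^∞` with `|k| ≤ K e^{ϑH}` (`0 < ϑ < 1/T`), `τ ≥ 0`:
`∫ φ (P_τ k) dx − ∫ φ k dx = ∫₀^τ ∫ (L̂φ + 2γφ)(x) (P_t k)(x) dx dt`. Proof: the compactly supported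
case for `k χ(H/(n+1))` and dominated convergence `n → ∞` in all three terms (bound (3.4)).
[cite: CuneoEckmannHairerReyBellet2018, §3 eq. (3.2)] -/
theorem integral_mul_act_sub_eq {ϑ K : ℝ} (hϑ0 : 0 < ϑ) (hϑ1 : ϑ < 1 / T)
    {k : PhaseSpace N → ℝ} (hk : ContDiff ℝ ∞ k)
    (hkb : ∀ y, |k y| ≤ K * Real.exp (ϑ * (pinnedChain ω₂ lam β γ).hamiltonian N y))
    {φ : PhaseSpace N → ℝ} (hφ : ContDiff ℝ ∞ φ) (hφc : HasCompactSupport φ) {τ : ℝ} (hτ : 0 ≤ τ) :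
    (∫ x, φ x * ∫ y, k y ∂((pinnedChain ω₂ lam β γ).langevinKernel N T T τ.toNNReal x)) -
        ∫ x, φ x * k x =
      ∫ t in (0 : ℝ)..τ, ∫ x,
        (sdeGenerator (fun y => -(pinnedChain ω₂ lam β γ).drift N y)
            ((pinnedChain ω₂ lam β γ).bathVecL N T) ((pinnedChain ω₂ lam β γ).bathVecR N T) φ x +
          2 * γ * φ x) *
        ∫ y, k y ∂((pinnedChain ω₂ lam β γ).langevinKernel N T T t.toNNReal x) := by
  set P := pinnedChain ω₂ lam β γ with hPdef
  have hP : P.IsConfining := pinnedChain_isConfining hω hl hβ hγ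
  have hU : ContDiff ℝ ∞ P.U := pinnedChain_contDiff_U ω₂ lam β γ
  have hV : ContDiff ℝ ∞ P.V := pinnedChain_contDiff_V ω₂ lam β γ
  set Hm := P.hamiltonian N with hHm
  have hHs : ContDiff ℝ ∞ Hm := pinnedChain_contDiff_hamiltonian ω₂ lam β γ N
  have hHc : Continuous Hm := hHs.continuous
  have hkc : Continuous k := hk.continuous
  set κ : ℝ → Kernel (PhaseSpace N) (PhaseSpace N) := fun t => P.langevinKernel N T T t.toNNReal
    with hκ
  set Lφ := sdeGenerator (fun y => -P.drift N y) (P.bathVecL N T) (P.bathVecR N T) φ with hLφ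
  set ψ : PhaseSpace N → ℝ := fun x => Lφ x + 2 * γ * φ x with hψ
  have hψc : Continuous ψ :=
    (continuous_sdeGenerator _ _ (P.contDiff_drift hU hV N).continuous.neg
      (hφ.of_le (by norm_cast))).add (continuous_const.mul hφ.continuous)
  have hψs : HasCompactSupport ψ := (hasCompactSupport_sdeGenerator _ _ hφc).add hφc.mul_left
  -- the cutoffs
  set kn : ℕ → PhaseSpace N → ℝ := fun n y => k y * smoothCutoff (Hm y / (n + 1)) with hkn
  have hRpos : ∀ n : ℕ, (0 : ℝ) < n + 1 := fun n => by positivity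
  have hkns : ∀ n, ContDiff ℝ ∞ (kn n) := fun n =>
    hk.mul (contDiff_smoothCutoff.comp (hHs.div_const _))
  have hknc : ∀ n, Continuous (kn n) := fun n => (hkns n).continuous
  have hknsupp : ∀ n, HasCompactSupport (kn n) := fun n => by
    refine HasCompactSupport.intro (hP.isCompact_setOf_hamiltonian_le N (2 * (n + 1))) fun y hy => ?_
    simp only [mem_setOf_eq, not_le] at hy
    have h2 : 2 ≤ Hm y / (n + 1) := by rw [le_div_iff₀ (hRpos n)]; linarith
    show k y * smoothCutoff (Hm y / (n + 1)) = 0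
    rw [smoothCutoff_of_two_le h2, mul_zero]
  have hknle : ∀ n y, |kn n y| ≤ |k y| := fun n y => by
    rw [hkn]; dsimp only
    rw [abs_mul, abs_of_nonneg (smoothCutoff_nonneg _)]
    exact mul_le_of_le_one_right (abs_nonneg _) (smoothCutoff_le_one _)
  have hlim : ∀ y, Tendsto (fun n => kn n y) atTop (𝓝 (k y)) := fun y => by
    refine tendsto_const_nhds.congr' ?_
    obtain ⟨n₀, hn₀⟩ := exists_nat_ge (Hm y)
    filter_upwards [eventually_ge_atTop n₀] with n hn
    have h1 : Hm y / (n + 1) ≤ 1 := by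
      rw [div_le_one (hRpos n)]
      have : (n₀ : ℝ) ≤ n := by exact_mod_cast hn
      linarith
    show k y = k y * smoothCutoff (Hm y / (n + 1))
    rw [smoothCutoff_of_le_one h1, mul_one]
  -- the identity at cutoff level `n`
  have hEn : ∀ n, (∫ x, φ x * ∫ y, kn n y ∂(κ τ x)) - ∫ x, φ x * kn n x =
      ∫ t in (0 : ℝ)..τ, ∫ x, ψ x * ∫ y, kn n y ∂(κ t x) := fun n =>
    integral_mul_act_sub_eq_of_hasCompactSupport hω hl hβ hγ hN hφ hφc (hkns n) (hknsupp n) hτ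
  -- limits of the three terms
  have ha : Tendsto (fun n => ∫ x, φ x * ∫ y, kn n y ∂(κ τ x)) atTop
      (𝓝 (∫ x, φ x * ∫ y, k y ∂(κ τ x))) :=
    tendsto_integral_mul_act hω hl hβ hγ hN hT hϑ0 hϑ1 hkc hkb hknc hknle hlim hφ.continuous hφc _
  have hb : Tendsto (fun n => ∫ x, φ x * kn n x) atTop (𝓝 (∫ x, φ x * k x)) := by
    have hdom : Integrable (fun x => |φ x| * |k x|) volume :=
      (hφ.continuous.abs.mul hkc.abs).integrable_of_hasCompactSupport hφc.norm.mul_right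
    refine tendsto_integral_of_dominated_convergence (fun x => |φ x| * |k x|)
      (fun n => (hφ.continuous.mul (hknc n)).aestronglyMeasurable) hdom
      (fun n => Eventually.of_forall fun x => ?_)
      (Eventually.of_forall fun x => (hlim x).const_mul _)
    rw [norm_mul, Real.norm_eq_abs, Real.norm_eq_abs]
    exact mul_le_mul_of_nonneg_left (hknle n x) (abs_nonneg _)
  have hc : Tendsto (fun n => ∫ t in (0 : ℝ)..τ, ∫ x, ψ x * ∫ y, kn n y ∂(κ t x)) atTop
      (𝓝 (∫ t in (0 : ℝ)..τ, ∫ x, ψ x * ∫ y, k y ∂(κ t x))) := by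
    -- a uniform bound on `(0, τ]`
    set B : ℝ := ∫ x, |ψ x| * (K * Real.exp (ϑ * γ * (T + T) * τ) *
      Real.exp (ϑ * Hm x)) with hB
    have hmeas : ∀ n, Continuous fun t : ℝ => ∫ x, ψ x * ∫ y, kn n y ∂(κ t x) := fun n =>
      continuous_integral_mul_act hω hl hβ hγ hψc hψs (hknc n) (hknsupp n)
    refine intervalIntegral.tendsto_integral_filter_of_dominated_convergence (fun _ => B)
      (Eventually.of_forall fun n => (hmeas n).aestronglyMeasurable)
      (Eventually.of_forall fun n => Eventually.of_forall fun t ht => ?_)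
      intervalIntegrable_const (Eventually.of_forall fun t _ =>
        tendsto_integral_mul_act hω hl hβ hγ hN hT hϑ0 hϑ1 hkc hkb hknc hknle hlim hψc hψs _)
    have ht0 : 0 < t := by rw [uIoc_of_le hτ] at ht; exact ht.1
    have htτ : t ≤ τ := by rw [uIoc_of_le hτ] at ht; exact ht.2
    have hGint : Integrable (fun x => |ψ x| * (K * Real.exp (ϑ * γ * (T + T) * τ) *
        Real.exp (ϑ * Hm x))) volume := by
      refine Continuous.integrable_of_hasCompactSupport ?_ hψs.norm.mul_right
      fun_prop
    rw [Real.norm_eq_abs]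
    calc |∫ x, ψ x * ∫ y, kn n y ∂(κ t x)| ≤ ∫ x, |ψ x * ∫ y, kn n y ∂(κ t x)| :=
          abs_integral_le_integral_abs
      _ ≤ B := by
        refine integral_mono_of_nonneg (Eventually.of_forall fun x => abs_nonneg _) hGint
          (Eventually.of_forall fun x => ?_)
        obtain ⟨hkint, hbd⟩ := integral_abs_le_of_abs_le_exp hω hl hβ hγ hN hT hϑ0 hϑ1 hkc hkb
          t.toNNReal x
        dsimp only
        rw [abs_mul]
        refine mul_le_mul_of_nonneg_left ?_ (abs_nonneg _)
        have hexp : Real.exp (ϑ * γ * (T + T) * (t.toNNReal : ℝ)) ≤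
            Real.exp (ϑ * γ * (T + T) * τ) := by
          rw [Real.coe_toNNReal _ ht0.le]
          exact Real.exp_le_exp.2 (mul_le_mul_of_nonneg_left htτ (by positivity))
        have hK : 0 ≤ K := by
          have h := (abs_nonneg _).trans (hkb x)
          have he := Real.exp_pos (ϑ * Hm x)
          by_contra hK'
          push Not at hK'
          linarith [mul_neg_of_neg_of_pos hK' he]
        calc |∫ y, kn n y ∂(κ t x)| ≤ ∫ y, |kn n y| ∂(κ t x) := abs_integral_le_integral_abs
          _ ≤ ∫ y, |k y| ∂(κ t x) := integral_mono_of_nonneg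
              (Eventually.of_forall fun y => abs_nonneg _) hkint.abs (Eventually.of_forall (hknle n))
          _ ≤ K * Real.exp (ϑ * γ * (T + T) * (t.toNNReal : ℝ)) * Real.exp (ϑ * Hm x) := hbd
          _ ≤ K * Real.exp (ϑ * γ * (T + T) * τ) * Real.exp (ϑ * Hm x) := by gcongr
  have hEq : (fun n => (∫ x, φ x * ∫ y, kn n y ∂(κ τ x)) - ∫ x, φ x * kn n x) =
      fun n => ∫ t in (0 : ℝ)..τ, ∫ x, ψ x * ∫ y, kn n y ∂(κ t x) := funext hEn
  have h := (ha.sub hb)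
  rw [hEq] at h
  exact tendsto_nhds_unique h hc


/-- **Joint measurability of `(t, x) ↦ (P_{t⁺} k)(x)`** for continuous `k` (the transition kernels
are jointly measurable in `(t, x)`). [folklore] -/
theorem stronglyMeasurable_act_uncurry {k : PhaseSpace N → ℝ} (hk : Continuous k) :
    StronglyMeasurable fun q : ℝ × PhaseSpace N =>
      ∫ y, k y ∂((pinnedChain ω₂ lam β γ).langevinKernel N T T q.1.toNNReal q.2) := by
  set P := pinnedChain ω₂ lam β γ with hPdef
  have hP : P.IsConfining := pinnedChain_isConfining hω hl hβ hγ
  let κ₂ : Kernel (ℝ≥0 × PhaseSpace N) (PhaseSpace N) :=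
    { toFun := fun p => P.langevinKernel N T T p.1 p.2
      measurable' := hP.measurable_langevinKernel N T T }
  have hG : StronglyMeasurable fun p : ℝ≥0 × PhaseSpace N => ∫ y, k y ∂(κ₂ p) :=
    hk.stronglyMeasurable.integral_kernel (κ := κ₂)
  have h2 : StronglyMeasurable fun q : ℝ × PhaseSpace N => ∫ y, k y ∂(κ₂ (q.1.toNNReal, q.2)) :=
    hG.comp_measurable ((measurable_real_toNNReal.comp measurable_fst).prodMk measurable_snd)
  exact h2

/-- **Measurability of the forward integral `g₀(x) = ∫₀^∞ (P_t k)(x) dt`.** [folklore] -/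
theorem stronglyMeasurable_forwardIntegral {k : PhaseSpace N → ℝ} (hk : Continuous k) :
    StronglyMeasurable fun x : PhaseSpace N => ∫ t in Ioi (0 : ℝ),
      ∫ y, k y ∂((pinnedChain ω₂ lam β γ).langevinKernel N T T t.toNNReal x) := by
  have h := stronglyMeasurable_act_uncurry hω hl hβ hγ (T := T) hk
  have h' : StronglyMeasurable fun q : PhaseSpace N × ℝ =>
      ∫ y, k y ∂((pinnedChain ω₂ lam β γ).langevinKernel N T T q.2.toNNReal q.1) :=
    h.comp_measurable (g := fun q : PhaseSpace N × ℝ => (q.2, q.1)) (measurable_snd.prodMk measurable_fst)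
  exact h'.integral_prod_right' (ν := volume.restrict (Ioi (0 : ℝ)))

omit hω hl hβ hγ in
/-- **The a-priori bound `|g₀| ≤ M C_c e^{ϑH}`** (`C_c = ∫₀^∞ e^{−ct} dt`) from the decay
`|P_t k(z)| ≤ M e^{ϑH(z)} e^{−ct}`. [folklore] -/
theorem abs_forwardIntegral_le (k : PhaseSpace N → ℝ) {ϑ M c : ℝ} (hc : 0 < c)
    (hdecay : ∀ (t : ℝ≥0) (z : PhaseSpace N),
      |∫ y, k y ∂((pinnedChain ω₂ lam β γ).langevinKernel N T T t z)| ≤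
        M * Real.exp (ϑ * (pinnedChain ω₂ lam β γ).hamiltonian N z) * Real.exp (-c * t))
    (x : PhaseSpace N) :
    |∫ t in Ioi (0 : ℝ), ∫ y, k y ∂((pinnedChain ω₂ lam β γ).langevinKernel N T T t.toNNReal x)| ≤
      M * (∫ t in Ioi (0 : ℝ), Real.exp (-c * t)) *
        Real.exp (ϑ * (pinnedChain ω₂ lam β γ).hamiltonian N x) := by
  set P := pinnedChain ω₂ lam β γ with hPdef
  set E := Real.exp (ϑ * P.hamiltonian N x) with hE
  have hbound : ∀ t : ℝ, t ∈ Ioi (0 : ℝ) →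
      ‖∫ y, k y ∂(P.langevinKernel N T T t.toNNReal x)‖ ≤ M * E * Real.exp (-c * t) := by
    intro t ht
    rw [Real.norm_eq_abs]
    have h := hdecay t.toNNReal x
    rwa [Real.coe_toNNReal _ (le_of_lt ht)] at h
  have hint : IntegrableOn (fun t : ℝ => M * E * Real.exp (-c * t)) (Ioi 0) :=
    (exp_neg_integrableOn_Ioi 0 hc).const_mul (M * E)
  have h := norm_integral_le_of_norm_le hint ((ae_restrict_iff' measurableSet_Ioi).2
    (Eventually.of_forall hbound))
  rw [Real.norm_eq_abs] at h
  calc _ ≤ ∫ t in Ioi (0 : ℝ), M * E * Real.exp (-c * t) := h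
    _ = M * (∫ t in Ioi (0 : ℝ), Real.exp (-c * t)) * E := by rw [integral_const_mul]; ring

include hN hT in
/-- **The Poisson equation in `𝓓'` for the forward integral.** For the pinned chain at equal
temperatures `T` (`ω₂ > 0`, `lam, β, γ ≥ 0`, `N ≥ 1`), a smooth `k` with `|k| ≤ K e^{ϑH}`
(`0 < ϑ < 1/T`) and DECAYING averages `|P_t k(z)| ≤ M e^{ϑH(z)} e^{−ct}` (`c > 0`), the forward
integral `g₀ = ∫₀^∞ P_t k dt` satisfies `∫ (L̂φ + 2γφ) g₀ dx = −∫ φ k dx` for all `φ ∈ C_c^∞`, i.e.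
`L g₀ = −k` in the sense of distributions (`ᵗL = L̂ + 2γ`). Proof: `τ → ∞` in
`integral_mul_act_sub_eq` and Fubini. [folklore] -/
theorem integral_transpose_mul_forwardIntegral {ϑ K M c : ℝ} (hϑ0 : 0 < ϑ) (hϑ1 : ϑ < 1 / T)
    (hc : 0 < c) {k : PhaseSpace N → ℝ} (hk : ContDiff ℝ ∞ k)
    (hkb : ∀ y, |k y| ≤ K * Real.exp (ϑ * (pinnedChain ω₂ lam β γ).hamiltonian N y))
    (hdecay : ∀ (t : ℝ≥0) (z : PhaseSpace N),
      |∫ y, k y ∂((pinnedChain ω₂ lam β γ).langevinKernel N T T t z)| ≤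
        M * Real.exp (ϑ * (pinnedChain ω₂ lam β γ).hamiltonian N z) * Real.exp (-c * t))
    {φ : PhaseSpace N → ℝ} (hφ : ContDiff ℝ ∞ φ) (hφc : HasCompactSupport φ) :
    ∫ x, (sdeGenerator (fun y => -(pinnedChain ω₂ lam β γ).drift N y)
          ((pinnedChain ω₂ lam β γ).bathVecL N T) ((pinnedChain ω₂ lam β γ).bathVecR N T) φ x +
        2 * γ * φ x) *
      (∫ t in Ioi (0 : ℝ), ∫ y, k y ∂((pinnedChain ω₂ lam β γ).langevinKernel N T T t.toNNReal x)) =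
      -∫ x, φ x * k x := by
  set P := pinnedChain ω₂ lam β γ with hPdef
  have hP : P.IsConfining := pinnedChain_isConfining hω hl hβ hγ
  have hU : ContDiff ℝ ∞ P.U := pinnedChain_contDiff_U ω₂ lam β γ
  have hV : ContDiff ℝ ∞ P.V := pinnedChain_contDiff_V ω₂ lam β γ
  set Hm := P.hamiltonian N with hHm
  have hHc : Continuous Hm := pinnedChain_continuous_hamiltonian ω₂ lam β γ N
  have hkc : Continuous k := hk.continuous
  have hφc' : Continuous φ := hφ.continuous
  set U : ℝ → PhaseSpace N → ℝ := fun t x => ∫ y, k y ∂(P.langevinKernel N T T t.toNNReal x) with hU_def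
  set Lφ := sdeGenerator (fun y => -P.drift N y) (P.bathVecL N T) (P.bathVecR N T) φ with hLφ
  set ψ : PhaseSpace N → ℝ := fun x => Lφ x + 2 * γ * φ x with hψ
  have hψc : Continuous ψ :=
    (continuous_sdeGenerator _ _ (P.contDiff_drift hU hV N).continuous.neg
      (hφ.of_le (by norm_cast))).add (continuous_const.mul hφ.continuous)
  have hψs : HasCompactSupport ψ := (hasCompactSupport_sdeGenerator _ _ hφc).add hφc.mul_left
  -- measurability and the pointwise decay of `U`
  have hUm : StronglyMeasurable (Function.uncurry U) :=
    stronglyMeasurable_act_uncurry hω hl hβ hγ (T := T) hkc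
  have hUb : ∀ t x, |U t x| ≤ M * Real.exp (ϑ * Hm x) * Real.exp (-c * t) := by
    intro t x
    have h := hdecay t.toNNReal x
    refine h.trans (mul_le_mul_of_nonneg_left (Real.exp_le_exp.2 ?_) ?_)
    · have : t ≤ (t.toNNReal : ℝ) := Real.le_coe_toNNReal t
      nlinarith
    · have h0 : 0 ≤ M * Real.exp (ϑ * Hm x) * Real.exp (-c * (t.toNNReal : ℝ)) :=
        (abs_nonneg _).trans h
      exact nonneg_of_mul_nonneg_left h0 (Real.exp_pos _)
  -- the time slices `I t = ∫ ψ (P_t k) dx` are integrable on `(0, ∞)`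
  set A : PhaseSpace N → ℝ := fun x => |ψ x| * (M * Real.exp (ϑ * Hm x)) with hA
  have hAc : Continuous A := by rw [hA]; fun_prop
  have hAs : HasCompactSupport A := hψs.norm.mul_right
  have hAint : Integrable A volume := hAc.integrable_of_hasCompactSupport hAs
  set F : ℝ × PhaseSpace N → ℝ := fun q => ψ q.2 * U q.1 q.2 with hF
  have hFm : StronglyMeasurable F := ((hψc.comp continuous_snd).stronglyMeasurable).mul hUm
  have hFb : ∀ q : ℝ × PhaseSpace N, ‖F q‖ ≤ Real.exp (-c * q.1) * A q.2 := by
    rintro ⟨t, x⟩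
    rw [Real.norm_eq_abs, hF]
    dsimp only
    rw [abs_mul, hA]
    dsimp only
    have := hUb t x
    have hψ0 := abs_nonneg (ψ x)
    nlinarith
  have hprod : Integrable F ((volume.restrict (Ioi (0 : ℝ))).prod volume) := by
    have hg : Integrable (fun q : ℝ × PhaseSpace N => Real.exp (-c * q.1) * A q.2)
        ((volume.restrict (Ioi (0 : ℝ))).prod volume) :=
      Integrable.mul_prod (exp_neg_integrableOn_Ioi 0 hc) hAint
    exact hg.mono' hFm.aestronglyMeasurable (Eventually.of_forall hFb)
  set I : ℝ → ℝ := fun t => ∫ x, ψ x * U t x with hI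
  have hIm : StronglyMeasurable I := hFm.integral_prod_right' (ν := volume)
  have hIb : ∀ t, ‖I t‖ ≤ (∫ x, A x) * Real.exp (-c * t) := by
    intro t
    have h := norm_integral_le_of_norm_le (hAint.const_mul (Real.exp (-c * t)))
      (Eventually.of_forall fun x => (hFb (t, x)))
    calc ‖I t‖ ≤ ∫ x, Real.exp (-c * t) * A x := h
      _ = (∫ x, A x) * Real.exp (-c * t) := by rw [integral_const_mul]; ring
  have hIint : IntegrableOn I (Ioi 0) :=
    Integrable.mono' (((exp_neg_integrableOn_Ioi 0 hc).const_mul (∫ x, A x)).congr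
      (Eventually.of_forall fun t => by ring)) hIm.aestronglyMeasurable (Eventually.of_forall hIb)
  -- the identity of file III, for every `τ ≥ 0`
  have hEq : ∀ τ : ℝ, 0 ≤ τ → (∫ x, φ x * U τ x) - ∫ x, φ x * k x = ∫ t in (0 : ℝ)..τ, I t :=
    fun τ hτ => integral_mul_act_sub_eq hω hl hβ hγ hN hT hϑ0 hϑ1 hk hkb hφ hφc hτ
  -- `τ → ∞`
  have hlim1 : Tendsto (fun τ : ℝ => ∫ t in (0 : ℝ)..τ, I t) atTop (𝓝 (∫ t in Ioi (0 : ℝ), I t)) :=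
    intervalIntegral_tendsto_integral_Ioi 0 hIint tendsto_id
  have hφA : Integrable (fun x => |φ x| * (M * Real.exp (ϑ * Hm x))) volume := by
    refine Continuous.integrable_of_hasCompactSupport (by fun_prop) hφc.norm.mul_right
  have hlim0 : Tendsto (fun τ : ℝ => ∫ x, φ x * U τ x) atTop (𝓝 0) := by
    have hexp : Tendsto (fun τ : ℝ => (∫ x, |φ x| * (M * Real.exp (ϑ * Hm x))) *
        Real.exp (-c * τ)) atTop (𝓝 0) := by
      have h1 : Tendsto (fun τ : ℝ => Real.exp (-c * τ)) atTop (𝓝 0) := by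
        have := Real.tendsto_exp_neg_atTop_nhds_zero.comp (tendsto_id.const_mul_atTop hc)
        refine this.congr fun τ => ?_
        simp [neg_mul]
      simpa using h1.const_mul (∫ x, |φ x| * (M * Real.exp (ϑ * Hm x)))
    refine squeeze_zero_norm' (Eventually.of_forall fun τ => ?_) hexp
    have h := norm_integral_le_of_norm_le (hφA.const_mul (Real.exp (-c * τ)))
      (Eventually.of_forall fun x => show ‖φ x * U τ x‖ ≤
        Real.exp (-c * τ) * (|φ x| * (M * Real.exp (ϑ * Hm x))) from by
          rw [norm_mul, Real.norm_eq_abs, Real.norm_eq_abs]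
          have := hUb τ x
          have hφ0 := abs_nonneg (φ x)
          nlinarith)
    calc ‖∫ x, φ x * U τ x‖ ≤ ∫ x, Real.exp (-c * τ) * (|φ x| * (M * Real.exp (ϑ * Hm x))) := h
      _ = _ := by rw [integral_const_mul]; ring
  have hlim2 : Tendsto (fun τ : ℝ => ∫ t in (0 : ℝ)..τ, I t) atTop (𝓝 (0 - ∫ x, φ x * k x)) := by
    refine (hlim0.sub tendsto_const_nhds).congr' ?_
    filter_upwards [eventually_ge_atTop (0 : ℝ)] with τ hτ
    exact hEq τ hτ
  have hval : ∫ t in Ioi (0 : ℝ), I t = -∫ x, φ x * k x := by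
    have := tendsto_nhds_unique hlim1 hlim2
    rw [this, zero_sub]
  -- Fubini
  have hswap : ∫ t in Ioi (0 : ℝ), I t = ∫ x, ψ x * ∫ t in Ioi (0 : ℝ), U t x := by
    have h := integral_integral_swap (μ := volume.restrict (Ioi (0 : ℝ))) (ν := (volume : Measure (PhaseSpace N)))
      (f := fun t x => ψ x * U t x) hprod
    rw [show (∫ t in Ioi (0 : ℝ), I t) = ∫ t in Ioi (0 : ℝ), ∫ x, ψ x * U t x from rfl, h]
    exact integral_congr_ae (ae_of_all _ fun x => integral_const_mul _ _)
  rw [← hval, hswap]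

end Pinned

/-- **Registered helper stub of this file** (`helper_plainForwardFieldPoisson`): the Poisson equation
in `𝓓'` for the forward integral `∫₀^∞ P_t k dt` (= `integral_transpose_mul_forwardIntegral`).
[cite: CuneoEckmannHairerReyBellet2018, Thm 2.13 (3)] -/
theorem helper_plainForwardFieldPoisson : ∀ {ω₂ lam β γ : ℝ}, 0 < ω₂ → 0 ≤ lam → 0 ≤ β → 0 ≤ γ → ∀ {N : ℕ}, 0 < N → ∀ {T : ℝ}, 0 < T → ∀ {ϑ K M c : ℝ}, 0 < ϑ → ϑ < 1 / T → 0 < c → ∀ {k : PhaseSpace N → ℝ}, ContDiff ℝ ∞ k → (∀ y, |k y| ≤ K * Real.exp (ϑ * (pinnedChain ω₂ lam β γ).hamiltonian N y)) → (∀ (t : ℝ≥0) (z : PhaseSpace N), |∫ y, k y ∂((pinnedChain ω₂ lam β γ).langevinKernel N T T t z)| ≤ M * Real.exp (ϑ * (pinnedChain ω₂ lam β γ).hamiltonian N z) * Real.exp (-c * t)) → ∀ {φ : PhaseSpace N → ℝ}, ContDiff ℝ ∞ φ → HasCompactSupport φ → ∫ x, (sdeGenerator (fun y => -(pinnedChain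 ω₂ lam β γ).drift N y) ((pinnedChain ω₂ lam β γ).bathVecL N T) ((pinnedChain ω₂ lam β γ).bathVecR N T) φ x + 2 * γ * φ x) * (∫ t in Ioi (0 : ℝ), ∫ y, k y ∂((pinnedChain ω₂ lam β γ).langevinKernel N T T t.toNNReal x)) = -∫ x, φ x * k x :=
  fun hω hl hβ hγ _ hN _ hT _ _ _ _ hϑ0 hϑ1 hc _ hk hkb hdecay _ hφ hφc =>
    integral_transpose_mul_forwardIntegral hω hl hβ hγ hN hT hϑ0 hϑ1 hc hk hkb hdecay hφ hφc

end Summit.AtomisticToContinuum.FouriersLaw.Theorems.SuperadditiveResistance.PlainForwardField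

end
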